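import Summits.QuantumFields.YangMills.Theses.FradkinShenkerFlow
import Summits.QuantumFields.YangMills.Theses.LangevinControlUV
import Summits.QuantumFields.YangMills.Theorems.FradkinShenkerFlowFiniteSusceptibilityWeakCouplingSiblingFunnel
import HarnessLib

/-!
# `FiniteSusceptibilityWeakCoupling` — funnel entry from the lattice gap in UV units (route `LangevinControlUV`)

Crux `stmt-QuantumFields-9442` (`FradkinShenkerFlow.FiniteSusceptibilityWeakCoupling`, line
`sup-axis-reflection-transfer`). Attachment of the tier-deciding pair of route `LangevinControlUV`:
`FemtoCurvatureTwoPointC` (item `stmt-QuantumFields-16204`: a CONTINUOUS unit map `a` with `a(β) > 0` carrying the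
femto two-point package) and `LatticeGapInUVUnitsC` (item `stmt-QuantumFields-16206`: for every continuous `a`
carrying that package, volume-uniform exponential clustering of all gauge-invariant pairs at rate `c₁ · a(β)` for
`β ≥ β₂`, tori `S ≥ S₁(β)`). At each fixed `β ≥ β₂` the rate `m(β) := c₁ · a(β)` is positive, so the pair is an
instance of the landed `finiteSusceptibilityWeakCoupling_of_timeClusteringEventually` (`…SiblingFunnel`): the
pair closes the crux by one modus ponens. The typed (`∀ a`, resp. `∃ a` without continuity) support items
`FemtoCurvatureTwoPoint` (9363) and `LatticeGapInUVUnits` (9366) give the crux the same way. Both items fix the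
Borel σ-algebra `borel G`; an arbitrary `[BorelSpace G]` structure is rewritten to it by `BorelSpace.measurable_eq`.
Every implication holds for every compact `G`; simplicity is only carried through the hypotheses.
-/

set_option autoImplicit false

noncomputable section

open MeasureTheory
open Literature.MathematicalPhysics.QuantumFieldTheory hiding Site ZdEdge
open Literature.MathematicalPhysics.QuantumLattice
open Summit.QuantumFields.YangMills.Theses

namespace Summit.QuantumFields.YangMills.Theorems.FiniteSusceptibilityWeakCoupling

/-- **Lattice gap in continuous UV units ⇒ crux** (attachment of items `stmt-QuantumFields-16204` and
`stmt-QuantumFields-16206`): `FemtoCurvatureTwoPointC → LatticeGapInUVUnitsC → FiniteSusceptibilityWeakCoupling`.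
The package item supplies a continuous unit map `a` with `a(β) > 0`; the gap item applied to it gives clustering
at rate `c₁ a(β) > 0` beyond the volume threshold `S₁(β)` for `β ≥ β₂`, which is the hypothesis of
`finiteSusceptibilityWeakCoupling_of_timeClusteringEventually`. -/
theorem finiteSusceptibilityWeakCoupling_of_latticeGapInUVUnitsC
    (hUV : LangevinControlUV.FemtoCurvatureTwoPointC) (hIR : LangevinControlUV.LatticeGapInUVUnitsC) :
    FradkinShenkerFlow.FiniteSusceptibilityWeakCoupling := by
  refine finiteSusceptibilityWeakCoupling_of_timeClusteringEventually fun G _ _ _ _ iM iB hG r => ?_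
  have hM : iM = borel G := BorelSpace.measurable_eq
  subst hM
  obtain ⟨a, ha, hP⟩ := hUV G hG r
  obtain ⟨c₁, β₂, S₁, hc₁, hAB⟩ := hIR G hG r a ha hP
  obtain ⟨Γ, β₀, ℓ₀, c, C, -, -, hapos, -⟩ := hP
  refine ⟨β₂, fun β hβ => ⟨c₁ * a β, mul_pos hc₁ (hapos β), fun A B => ?_⟩⟩
  obtain ⟨K, hK⟩ := hAB A B
  exact ⟨K, S₁ β, fun S hS n hn => hK β hβ S n hS hn⟩

/-- **Typed variant** (support items `stmt-QuantumFields-9363` and `stmt-QuantumFields-9366`):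
`FemtoCurvatureTwoPoint → LatticeGapInUVUnits → FiniteSusceptibilityWeakCoupling` — the typed gap item serves every
unit map carrying the package, in particular the one the typed package item provides. -/
theorem finiteSusceptibilityWeakCoupling_of_latticeGapInUVUnits
    (hUV : LangevinControlUV.FemtoCurvatureTwoPoint) (hIR : LangevinControlUV.LatticeGapInUVUnits) :
    FradkinShenkerFlow.FiniteSusceptibilityWeakCoupling := by
  refine finiteSusceptibilityWeakCoupling_of_timeClusteringEventually fun G _ _ _ _ iM iB hG r => ?_
  have hM : iM = borel G := BorelSpace.measurable_eq
  subst hM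
  obtain ⟨a, hP⟩ := hUV G hG r
  obtain ⟨c₁, β₂, S₁, hc₁, hAB⟩ := hIR G hG r a hP
  obtain ⟨Γ, β₀, ℓ₀, c, C, -, -, hapos, -⟩ := hP
  refine ⟨β₂, fun β hβ => ⟨c₁ * a β, mul_pos hc₁ (hapos β), fun A B => ?_⟩⟩
  obtain ⟨K, hK⟩ := hAB A B
  exact ⟨K, S₁ β, fun S hS n hn => hK β hβ S n hS hn⟩

/-- **Registered form** (stub `stub_cruxOfLatticeGapInUVUnitsC` of item stmt-QuantumFields-9442): hypotheses the
decls of items 16204 and 16206 by name, conclusion the crux by name. -/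
theorem stub_cruxOfLatticeGapInUVUnitsC : Summit.QuantumFields.YangMills.Theses.LangevinControlUV.FemtoCurvatureTwoPointC → Summit.QuantumFields.YangMills.Theses.LangevinControlUV.LatticeGapInUVUnitsC → Summit.QuantumFields.YangMills.Theses.FradkinShenkerFlow.FiniteSusceptibilityWeakCoupling :=
  finiteSusceptibilityWeakCoupling_of_latticeGapInUVUnitsC

end Summit.QuantumFields.YangMills.Theorems.FiniteSusceptibilityWeakCoupling

end
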